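import Mathlib

/-!
# Sketch v3 — crux idea «graded-hypervirial-rebudget» (K1 of «hubbard-tc-thermcert-1»,
`TcThermcert1.ThermalStiffnessCeilingU8b10_le_1o8 : ObsThermalStiffnessSeqCeilingAtBeta 0 8 (7/8) 10 (1/8)`)

v3 addition (idea-4 g2): the **Schrieffer–Wolff one-word decomposition**. Finite-matrix level, exact algebra, any
stationary state `ρ` (`ρH = Hρ`, canonical-sector Gibbs included), `H = K + U•D` with `D` Hermitian (double occupancy).
Grading data: `Tp` = docc-RAISING part of the x-hopping (`D Tp − Tp D = Tp`), `Jp` = docc-RAISING part of the total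
x-current (`D Jp − Jp D = Jp`), `J0` its docc-conserving part (`D J0 = J0 D`); lowering parts are the adjoints.
The SW trial generator is `O = i(Jp − Jpᴴ)` (Hermitian, even, gauge-invariant, range 1 — an admissible `a` of the tree hook
`ObsThermalStiffnessSeqCeilingAtBeta_of_torusLimit_trialGeneratorWord_le` with `r = 1`), used at the FIXED amplitude
`λ = 1/U` (first-order SW, Harris–Lange 1967 §III; MacDonald–Girvin–Yoshioka 1988 eq. (2.7)).

Identities recorded here (all exact):
* `comm_D_swGen`      : `[D, O] = i(Jp + Jpᴴ)`                       (the generator is off-diagonal in the docc grading);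
* `doubleComm_swGen`  : `[O, [D, O]] = 2(JpᴴJp − JpJpᴴ)`            (the `U`-part of the word `m_a` is a docc-CONSERVING
                                                                      two-current word: no energy bracket, no `U d⁺ − e⁻`);
* `SWWordExpansion`   : the trial word at `λ = 1/U`,
    `W = ½k + (1/U)·i[J,O] + (1/(2U²))·[O,[H,O]]`, has expectation
    `Tr ρW = ½Tr ρk − (1/U)·Tr ρ(JpᴴJp − JpJpᴴ) − (1/U)·Tr ρ[J0, Jp − Jpᴴ] + (1/(2U²))·Tr ρ[O,[K,O]]`,
  i.e. an explicit polynomial in `1/U` whose coefficients are THREE static, `U`-independent, range-≤3 words. Combined with the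
  graded hypervirial identity of v2 (`U·Tr ρ(Tp+Tpᴴ) = Tr ρ[(Tp−Tpᴴ),K]`, file `Sketch-GradedFSum.lean`) the interband half
  `½κ^±` and the order-`1/U` gain are BOTH `(1/U)`·(two-hop words) whose two-site («hop-and-return») parts coincide — the
  leading-order cancellation `η_inter = 1 + O(zt/U)`; what is left at order `1/U` is three-site words only.
HONEST FRAMING: algebra only; no certificate, no number of record; no summit / rung / crux statement is proved; KT ceilings only;
NO lower bound on `T_c`.
-/

namespace Summit.Ventures.CertifiedManyBodySolver.Theses.TcThermcert1.GradedSW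

open Matrix

variable {n : Type} [Fintype n] [DecidableEq n]

/-- The adjoint of a grade-raising operator is grade-lowering (copied from v2 for self-containedness). -/
theorem grade_lower_of_raise (D Tp : Matrix n n ℂ) (hD : D.IsHermitian) (hT : D * Tp - Tp * D = Tp) :
    D * Tpᴴ - Tpᴴ * D = -Tpᴴ := by
  have h := congrArg Matrix.conjTranspose hT
  rw [Matrix.conjTranspose_sub, Matrix.conjTranspose_mul, Matrix.conjTranspose_mul, hD.eq] at h
  rw [← neg_sub, h]

/-- Stationarity: a state commuting with `H` kills every commutator (copied from v2). -/
theorem trace_mul_comm_sub_eq_zero (H X ρ : Matrix n n ℂ) (hρ : ρ * H = H * ρ) :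
    (ρ * (H * X - X * H)).trace = 0 := by
  have h1 : ρ * (H * X) = H * (ρ * X) := by rw [← Matrix.mul_assoc, hρ, Matrix.mul_assoc]
  rw [Matrix.mul_sub, Matrix.trace_sub, h1, Matrix.trace_mul_comm H (ρ * X), Matrix.mul_assoc, sub_self]

/-- The SW trial generator built from the docc-raising current `Jp`: `O = i(Jp − Jpᴴ)`. -/
def swGen (Jp : Matrix n n ℂ) : Matrix n n ℂ := Complex.I • (Jp - Jpᴴ)

theorem swGen_isHermitian (Jp : Matrix n n ℂ) : (swGen Jp).IsHermitian := by
  unfold swGen Matrix.IsHermitian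
  rw [Matrix.conjTranspose_smul, Matrix.conjTranspose_sub, Matrix.conjTranspose_conjTranspose,
    Complex.star_def, Complex.conj_I, neg_smul, ← smul_neg, neg_sub]

/-- `[D, O] = i(Jp + Jpᴴ)`: the SW generator is purely docc-off-diagonal. -/
theorem comm_D_swGen (D Jp : Matrix n n ℂ) (hD : D.IsHermitian) (hJ : D * Jp - Jp * D = Jp) :
    D * swGen Jp - swGen Jp * D = Complex.I • (Jp + Jpᴴ) := by
  have hL := grade_lower_of_raise D Jp hD hJ
  unfold swGen
  rw [Matrix.mul_smul, Matrix.smul_mul, ← smul_sub, Matrix.mul_sub, Matrix.sub_mul]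
  congr 1
  -- D*Jp - D*Jpᴴ - (Jp*D - Jpᴴ*D) = (D*Jp - Jp*D) - (D*Jpᴴ - Jpᴴ*D) = Jp - (-Jpᴴ)
  have : D * Jp - D * Jpᴴ - (Jp * D - Jpᴴ * D) = (D * Jp - Jp * D) - (D * Jpᴴ - Jpᴴ * D) := by abel
  rw [this, hJ, hL, sub_neg_eq_add]

/-- `[O, [D, O]] = 2(JpᴴJp − JpJpᴴ)`: the `U`-part of the double-commutator word `m_a` of the SW generator is a
docc-conserving two-current word (no energy bracket). -/
theorem doubleComm_swGen (D Jp : Matrix n n ℂ) (hD : D.IsHermitian) (hJ : D * Jp - Jp * D = Jp) :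
    swGen Jp * (D * swGen Jp - swGen Jp * D) - (D * swGen Jp - swGen Jp * D) * swGen Jp
      = (2 : ℂ) • (Jpᴴ * Jp - Jp * Jpᴴ) := by
  rw [comm_D_swGen D Jp hD hJ]
  unfold swGen
  rw [Matrix.smul_mul, Matrix.mul_smul, Matrix.smul_mul, Matrix.mul_smul, smul_smul, smul_smul, ← smul_sub,
    Complex.I_mul_I, Matrix.sub_mul, Matrix.mul_add, Matrix.mul_add, Matrix.add_mul, Matrix.mul_sub, Matrix.mul_sub]
  -- -1 • ((JpJp + JpJpᴴ - (JpᴴJp + JpᴴJpᴴ)) - ((JpJp - JpJpᴴ) + (JpᴴJp - JpᴴJpᴴ))) = 2 • (JpᴴJp - JpJpᴴ)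
  have : Jp * Jp + Jp * Jpᴴ - (Jpᴴ * Jp + Jpᴴ * Jpᴴ) - (Jp * Jp - Jp * Jpᴴ + (Jpᴴ * Jp - Jpᴴ * Jpᴴ))
      = -((2 : ℂ) • (Jpᴴ * Jp - Jp * Jpᴴ)) := by
    rw [two_smul]; abel
  rw [this, smul_neg, neg_smul, neg_neg, one_smul]

/-- `i[J, O] = −[J0, Jp − Jpᴴ] − 2(JpᴴJp − JpJpᴴ)` for `J = J0 + Jp + Jpᴴ`: the linear (order-`λ`) word. -/
theorem comm_J_swGen (J0 Jp : Matrix n n ℂ) :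
    Complex.I • ((J0 + Jp + Jpᴴ) * swGen Jp - swGen Jp * (J0 + Jp + Jpᴴ))
      = -(J0 * (Jp - Jpᴴ) - (Jp - Jpᴴ) * J0) - (2 : ℂ) • (Jpᴴ * Jp - Jp * Jpᴴ) := by
  unfold swGen
  simp only [Matrix.mul_smul, Matrix.smul_mul, smul_sub, smul_add, Matrix.add_mul, Matrix.mul_add, Matrix.mul_sub,
    Matrix.sub_mul, smul_smul, Complex.I_mul_I, neg_one_smul, two_smul, neg_sub, neg_add]
  abel

/-- **SW word expansion** (statement, the v3 first lemma). With `H = K + U•D`, `U ≠ 0`, `D` Hermitian, `Jp` docc-raising,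
`J0` docc-conserving, `J = J0 + Jp + Jpᴴ`, `O = swGen Jp` and ANY `ρ`, the trial word at the SW amplitude `λ = 1/U`,
`W = ½k + (1/U)·i[J,O] + (1/(2U²))·[O,[H,O]]`, satisfies
`Tr ρW = ½Tr ρk − (1/U)Tr ρ(JpᴴJp − JpJpᴴ) − (1/U)Tr ρ[J0, Jp − Jpᴴ] + (1/(2U²))Tr ρ[O,[K,O]]`:
three static `U`-independent words and explicit powers of `1/U` — no energy bracket. -/
def SWWordExpansion : Prop :=
  ∀ (n : Type) [Fintype n] [DecidableEq n] (k K D J0 Jp ρ : Matrix n n ℂ) (U : ℂ), U ≠ 0 →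
    D.IsHermitian → D * Jp - Jp * D = Jp → D * J0 = J0 * D →
    let O := swGen Jp
    let H := K + U • D
    let J := J0 + Jp + Jpᴴ
    (ρ * ((1 / 2 : ℂ) • k + (1 / U) • (Complex.I • (J * O - O * J))
        + (1 / (2 * U ^ 2)) • (O * (H * O - O * H) - (H * O - O * H) * O))).trace
      = (1 / 2 : ℂ) * (ρ * k).trace - (1 / U) * (ρ * (Jpᴴ * Jp - Jp * Jpᴴ)).trace
        - (1 / U) * (ρ * (J0 * (Jp - Jpᴴ) - (Jp - Jpᴴ) * J0)).trace
        + (1 / (2 * U ^ 2)) * (ρ * (O * (K * O - O * K) - (K * O - O * K) * O)).trace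

/-- **Leading-order SW optimality** (statement; informal content of v3 §B). In the notation of `SWWordExpansion` write
`X = Tr ρ(JpᴴJp − JpJpᴴ)`, `Y = Tr ρ[J0, Jp − Jpᴴ]`, `Z = Tr ρ[O,[K,O]]`. The Bogoliubov-optimal amplitude of the one word `O`
is `λ_opt = (2X + Y)/(2(2UX + Z))·2 = (2X + Y)/(2UX + Z)·1` hence `U·λ_opt = (1 + Y/(2X))/(1 + Z/(2UX))`, and the optimal
one-word gain is `(2X+Y)²/(2(2UX+Z))`; at `Y = Z = 0` this is `X/U`, which by the graded hypervirial identity equals the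
two-site («hop-and-return») part of the interband half `½κ^± = (1/U)·Tr ρ(Tpᴴ-first two-hop words)`. Recorded as the
algebraic identity behind «η_inter = 1 + O(zt/U), λ_opt → 1/U»; the size of `Y/X`, `Z/(UX)` and of the three-site parts is
float context (idea-4 g0 8-site tables; hubbard-tc-mod-2 j302529 12-site rows), not a theorem. -/
def SWOptimalAmplitude : Prop :=
  ∀ (X Y Z U : ℝ), 0 < U → 0 < 2 * U * X + Z → X ≠ 0 →
    (2 * X + Y) / (2 * U * X + Z) * U = (1 + Y / (2 * X)) / (1 + Z / (2 * U * X))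

theorem swOptimalAmplitude : SWOptimalAmplitude := by
  intro X Y Z U hU hden hX
  have hU' : U ≠ 0 := hU.ne'
  have hden' : 2 * U * X + Z ≠ 0 := hden.ne'
  have h2 : (2 : ℝ) ≠ 0 := two_ne_zero
  field_simp

/-- **SW word expansion** (proof): linear bookkeeping from `doubleComm_swGen` and `comm_J_swGen`. -/
theorem swWordExpansion : SWWordExpansion := by
  intro n _ _ k K D J0 Jp ρ U hU hD hJ hJ0
  dsimp only
  have hDD := doubleComm_swGen D Jp hD hJ
  have hJJ := comm_J_swGen J0 Jp
  have hsplit : swGen Jp * ((K + U • D) * swGen Jp - swGen Jp * (K + U • D))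
        - ((K + U • D) * swGen Jp - swGen Jp * (K + U • D)) * swGen Jp
      = (swGen Jp * (K * swGen Jp - swGen Jp * K) - (K * swGen Jp - swGen Jp * K) * swGen Jp)
        + U • (swGen Jp * (D * swGen Jp - swGen Jp * D) - (D * swGen Jp - swGen Jp * D) * swGen Jp) := by
    simp only [Matrix.add_mul, Matrix.mul_add, Matrix.smul_mul, Matrix.mul_smul, Matrix.mul_sub, Matrix.sub_mul,
      smul_sub]
    abel
  rw [hsplit, hDD, hJJ]
  simp only [Matrix.mul_add, Matrix.mul_sub, Matrix.mul_smul, Matrix.mul_neg, Matrix.trace_add, Matrix.trace_sub,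
    Matrix.trace_smul, Matrix.trace_neg, smul_eq_mul]
  field_simp
  ring

end Summit.Ventures.CertifiedManyBodySolver.Theses.TcThermcert1.GradedSW
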